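import Literature.AlgebraicGeometry.FormalGeometry.WittGEIsogenyCospan
import Literature.AlgebraicGeometry.FormalGeometry.WittGEIsogenyTransfer
import Literature.AlgebraicGeometry.FormalGeometry.WittGEFramesLocal
import Literature.AlgebraicGeometry.Morphisms.FormalModuleCompletion
import Literature.AlgebraicGeometry.Morphisms.FormalFunctionsModuleCokernel
import Literature.AlgebraicGeometry.Morphisms.CohAffineExactness
import Literature.AlgebraicGeometry.Modules.PullbackClosedImmersionUnit
import Literature.AlgebraicGeometry.Modules.PushforwardClosedImmersionExact
import Literature.AlgebraicGeometry.Modules.SheafHomFunctor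
import HarnessLib

/-!
# The unit `ι_*E → ρ_*ρ^*(ι_*E)` is an `a`-power isogeny for a vector bundle `E` on `V(aⁿ⁺¹)`

Helper file toward the crux `PadicSemiregularLift.FormalVectorBundlesAlgebraize`
(stmt-HodgeConjecture-14106), proper case via a Chow cover. Let `ρ : X' → X` be a morphism,
`a ∈ Γ(X, 𝒪_X)`, `ι : Z → X` a closed immersion "cut out by `aⁿ⁺¹`" (on every affine open `W`,
`ι♯_W` is onto with kernel `aⁿ⁺¹Γ(W, 𝒪_X)`; e.g. the thickening `X ⊗_W W/pⁿ⁺¹` of a `W(k)`-scheme),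
and `E` a finite locally free `𝒪_Z`-module; put `M = ι_*E`, `Q = 𝒪_X/aⁿ⁺¹` and let `η` be the unit
of `ρ^* ⊣ ρ_*`. Locally on `X`, `M ≅ Q^k` (a frame of `E` over `ι⁻¹V`); globally we only have the
COSPAN `⨁_k Q → j_*(M|_V) ← M` of morphisms bijective on the sections over the opens `W ≤ V`
(`exists_local_cospan`). Transporting along it (`…AlgebraizeIsogenyCospan`) the isogeny bounds of
`η_Q` (hypotheses; supplied by `…AlgebraizeUnitComparisonStructureSheaf` when `ρ_*𝒪_{X'} = 𝒪_X`):

* `unit_pushforward_torsion` — **if `η_Q` has kernel killed by `a^c₁` and cokernel killed by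
  `a^c₂`, then so does `η_M : ι_*E → ρ_*ρ^*(ι_*E)`** (`kernel.ι`/`cokernel.π` form).

Everything is proved; no definitions.

Provenance: Literature home (family `hodge`, layer `Literature/AlgebraicGeometry/FormalGeometry`, namespace
`Literature.AlgebraicGeometry.FormalGeometry.WittGrothendieckExistence…`) of the Summits-side
`Theorems/PadicSemiregularLiftFormalVectorBundlesAlgebraizeUnitComparison` (route `PadicSemiregularLift` / `AnchorTransport`,
Grothendieck existence for vector bundles over `W(k)`), which `Literature/` may not import; theorems only, no
named fact, no definition. Lane `lit-hodgefound`, seat p20.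
-/

noncomputable section

-- `TopCat.Presheaf`/`Scheme.Modules` are not reducible (as in Mathlib's `AlgebraicGeometry/Modules`).
set_option backward.isDefEq.respectTransparency false

open CategoryTheory CategoryTheory.Limits _root_.AlgebraicGeometry TopologicalSpace Opposite
open Literature.AlgebraicGeometry.Modules Literature.AlgebraicGeometry.Morphisms
open Literature.AlgebraicGeometry.Motives

universe u

namespace Literature.AlgebraicGeometry.FormalGeometry.WittGrothendieckExistence.FormalVectorBundlesAlgebraize

variable {X' X Z : Scheme.{u}} (ρ : X' ⟶ X) (ι : Z ⟶ X) (a : Γ(X, ⊤)) (n : ℕ)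

/-! ### The morphism `𝒪_X/aⁿ⁺¹ → N` attached to a global section of a module killed by `aⁿ⁺¹` -/

/-- The morphism `𝒪_X → N` attached to a global section `s` acts on sections by `r ↦ r • s|_W`. [cite: GortzWedhorn2023, proof of Thm. 24.94 and Prop. 24.95 (pp. 566–567), auxiliary step] -/
theorem exists_unitHom_of_section (N : X.Modules) (s : Γ(N, ⊤)) :
    ∃ ψ : unitModule X ⟶ N, ∀ (W : X.Opens) (r : Γ(unitModule X, W)),
      ψ.app W r = (show Γ(X, W) from r) • N.presheaf.map (homOfLE (le_top : W ≤ ⊤)).op s :=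
  ⟨N.unitHomEquiv.symm ((sectionsEquivTop N).symm s), fun _ _ => rfl⟩

/-- **The morphism `𝒪_X/aⁿ⁺¹ → N` attached to a global section of a module killed by `aⁿ⁺¹`.** [cite: GortzWedhorn2023, proof of Thm. 24.94 and Prop. 24.95 (pp. 566–567), auxiliary step] -/
theorem exists_quotHom_of_section (N : X.Modules) (hN : globalScalar N (a ^ (n + 1)) = 0)
    (s : Γ(N, ⊤)) :
    ∃ q : cmplObj a (unitModule X) n ⟶ N, ∀ (W : X.Opens) (r : Γ(unitModule X, W)),
      q.app W ((cmplπ a (unitModule X) n).app W r) =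
        (show Γ(X, W) from r) • N.presheaf.map (homOfLE (le_top : W ≤ ⊤)).op s := by
  obtain ⟨ψ, hψ⟩ := exists_unitHom_of_section N s
  have h0 : globalScalar (unitModule X) (a ^ (n + 1)) ≫ ψ = 0 := by
    rw [globalScalar_comp, hN, comp_zero]
  refine ⟨cokernel.desc _ ψ h0, fun W r => ?_⟩
  rw [← hψ W r, ← comp_app_apply' (cmplπ a (unitModule X) n) (cokernel.desc _ ψ h0) W r]
  change (cokernel.π _ ≫ cokernel.desc _ ψ h0).app W r = _
  rw [cokernel.π_desc]

/-- Sections of a finite direct sum decompose along `biproduct.ι`, `biproduct.π` (index type in any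
universe; `…AlgebraizePullbackUnitSections.biproduct_decomposition` has it in the universe of `X`). [cite: GortzWedhorn2023, proof of Thm. 24.94 and Prop. 24.95 (pp. 566–567), auxiliary step] -/
theorem biproduct_decomposition_univ {I : Type*} [Fintype I] (M : I → X.Modules) [HasBiproduct M]
    (V : X.Opens) (x : Γ(⨁ M, V)) :
    x = ∑ k, (biproduct.ι M k).app V ((biproduct.π M k).app V x) := by
  have h1 : (𝟙 (⨁ M) : ⨁ M ⟶ ⨁ M).app V x = x := rfl
  conv_lhs => rw [← h1, ← biproduct_total M, sum_app_apply]
  rfl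

/-! ### Local frames of `ι_*E` relative to `Z` -/

section Frames

variable [IsClosedImmersion ι] {E : Z.Modules} (hE : IsFiniteLocallyFree E)

include hE in
/-- **Local frames of a finite locally free `𝒪_Z`-module, indexed on the ambient scheme**: every
point of `X` has an open neighbourhood `V` and finitely many sections `b_i` of `E` over `ι⁻¹V`
which form a frame of `E` over `ι⁻¹W` for every open `W ≤ V` (outside the image of `ι`: the empty
frame). [cite: GortzWedhorn2023, proof of Thm. 24.94 and Prop. 24.95 (pp. 566–567), auxiliary step] -/
theorem exists_local_frame (x : X) :
    ∃ (V : X.Opens), x ∈ V ∧ ∃ (k : ℕ) (b : Fin k → Γ(E, ι ⁻¹ᵁ V)),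
      ∀ (W : X.Opens) (hW : W ≤ V), Function.Bijective fun y : Fin k → Γ(Z, ι ⁻¹ᵁ W) =>
        ∑ i, y i • E.presheaf.map (homOfLE (ι.preimage_mono hW)).op (b i) := by
  classical
  by_cases hx : x ∈ Set.range ι.base
  · obtain ⟨z, rfl⟩ := hx
    obtain ⟨U, hzU, I, hI, b₀, hb₀⟩ := PushforwardTransport.exists_frame_nhds_of_isFiniteLocallyFree hE z
    -- `U = ι⁻¹V` for an open `V` of `X` (closed embedding)
    obtain ⟨V', hV'open, hV'⟩ := (ι.isClosedEmbedding.isInducing.isOpen_iff).mp U.2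
    let V : X.Opens := ⟨V', hV'open⟩
    have hVU : ι ⁻¹ᵁ V = U := Opens.ext hV'
    have hzV : ι.base z ∈ V := by
      change z ∈ (ι ⁻¹ᵁ V : Set Z)
      rw [hVU]; exact hzU
    -- reindex the frame by `Fin k`
    let e := Fintype.equivFin I
    refine ⟨V, hzV, Fintype.card I,
      fun i => E.presheaf.map (homOfLE hVU.le).op (b₀ (e.symm i)), fun W hW => ?_⟩
    have hWU : ι ⁻¹ᵁ W ≤ U := (ι.preimage_mono hW).trans hVU.le
    have hb := hb₀ (ι ⁻¹ᵁ W) hWU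
    -- the reindexed sum is the original sum precomposed with `y ↦ y ∘ e`
    have hsum : (fun y : Fin (Fintype.card I) → Γ(Z, ι ⁻¹ᵁ W) => ∑ i, y i •
        E.presheaf.map (homOfLE (ι.preimage_mono hW)).op
          (E.presheaf.map (homOfLE hVU.le).op (b₀ (e.symm i)))) =
        (fun y' : I → Γ(Z, ι ⁻¹ᵁ W) => ∑ i, y' i • E.presheaf.map (homOfLE hWU).op (b₀ i)) ∘
          fun y => y ∘ e := by
      funext y
      change ∑ i, y i • _ = ∑ i, y (e i) • _
      rw [← e.symm.sum_comp]
      refine Finset.sum_congr rfl fun i _ => ?_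
      rw [Equiv.apply_symm_apply, ← CategoryTheory.comp_apply, ← Functor.map_comp]
      rfl
    rw [hsum]
    exact hb.comp (e.arrowCongr (Equiv.refl _)).symm.bijective
  · -- outside the image of `ι`: the empty frame
    let V : X.Opens := ⟨(Set.range ι.base)ᶜ, ι.isClosedEmbedding.isClosed_range.isOpen_compl⟩
    refine ⟨V, hx, 0, Fin.elim0, fun W hW => ?_⟩
    have hout : ∀ z : Z, ι.base z ∉ W := fun z hz => hW hz ⟨z, rfl⟩
    refine ⟨fun y y' _ => funext fun i => i.elim0, fun t => ⟨Fin.elim0, ?_⟩⟩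
    exact eq_of_preimage_eq_bot ι E hout _ _

end Frames

/-! ### The local cospan and its bijectivity -/

section Cospan

variable [IsClosedImmersion ι] [IsLocallyNoetherian X]
  (hcut : ∀ W : X.Opens, IsAffineOpen W → Function.Surjective (ι.app W) ∧
    ∀ r : Γ(X, W), ι.app W r = 0 ↔
      ∃ c : Γ(X, W), r = X.presheaf.map (homOfLE (le_top : W ≤ ⊤)).op (a ^ (n + 1)) * c)
  (ha : ι.appTop (a ^ (n + 1)) = 0)
  {E : Z.Modules} (hE : IsFiniteLocallyFree E)

omit [IsClosedImmersion ι] [IsLocallyNoetherian X] in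
include ha in
/-- `aⁿ⁺¹` kills `ι_*P`. [cite: GortzWedhorn2023, proof of Thm. 24.94 and Prop. 24.95 (pp. 566–567), auxiliary step] -/
theorem globalScalar_pow_pushforward_eq_zero (P : Z.Modules) :
    globalScalar ((Scheme.Modules.pushforward ι).obj P) (a ^ (n + 1)) = 0 := by
  rw [← pushforward_map_globalScalar, ha, globalScalar_zero, Functor.map_zero]

include hcut ha hE in
/-- **The local cospan.** Every point of `X` has an open neighbourhood `V`, a number `k` and a
morphism `φ₁ : ⨁_k 𝒪_X/aⁿ⁺¹ → j_*((ι_*E)|_V)` which is bijective on the sections over every affine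
open `W ≤ V` (where `j_*((ι_*E)|_V)` receives `ι_*E` by the unit of `(-)|_V ⊣ j_*`, itself bijective
on the sections over the opens `W ≤ V`). [cite: GortzWedhorn2023, proof of Thm. 24.94 and Prop. 24.95 (pp. 566–567), auxiliary step] -/
theorem exists_local_cospan [HasFiniteBiproducts X.Modules] (x : X) :
    ∃ (V : X.Opens), x ∈ V ∧ ∃ (k : ℕ)
      (φ₁ : (⨁ fun _ : Fin k => cmplObj a (unitModule X) n) ⟶
        (Scheme.Modules.pushforward V.ι).obj ((Scheme.Modules.restrictFunctor V.ι).obj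
          ((Scheme.Modules.pushforward ι).obj E))),
      ∀ (W : X.Opens), W ≤ V → IsAffineOpen W → Function.Bijective (φ₁.app W) := by
  classical
  obtain ⟨V, hxV, k, b, hb⟩ := exists_local_frame ι hE x
  -- notation
  let O : X.Modules := unitModule X
  let Q : X.Modules := cmplObj a O n
  let M : X.Modules := (Scheme.Modules.pushforward ι).obj E
  let J : X.Modules :=
    (Scheme.Modules.pushforward V.ι).obj ((Scheme.Modules.restrictFunctor V.ι).obj M)
  let φ₂ : M ⟶ J := (Scheme.Modules.restrictAdjunction V.ι).unit.app M
  -- `aⁿ⁺¹` kills `J = j_*(M|_V)`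
  have hM : globalScalar M (a ^ (n + 1)) = 0 := globalScalar_pow_pushforward_eq_zero ι a n ha E
  have hJ : globalScalar J (a ^ (n + 1)) = 0 := by
    have h1 : globalScalar ((Scheme.Modules.restrictFunctor V.ι).obj M) (V.ι.appTop (a ^ (n + 1))) =
        (Scheme.Modules.restrictFunctor V.ι).map (globalScalar M (a ^ (n + 1))) :=
      (restrictFunctor_map_globalScalar V M (a ^ (n + 1)) _ rfl).symm
    change globalScalar ((Scheme.Modules.pushforward V.ι).obj _) (a ^ (n + 1)) = 0
    rw [← pushforward_map_globalScalar, h1, hM, Functor.map_zero, Functor.map_zero]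
  -- the global sections `s_i` of `J` given by the frame
  let s : Fin k → Γ(J, ⊤) := fun i => M.presheaf.map (homOfLE (V.ι_image_le _)).op (b i)
  choose q hq using fun i => exists_quotHom_of_section a n J hJ (s i)
  refine ⟨V, hxV, k, biproduct.desc q, fun W hWV hW => ?_⟩
  -- `s_i|_W = φ₂ (b_i|_W)` (two restrictions of `b_i`)
  have hsW : ∀ i, J.presheaf.map (homOfLE (le_top : W ≤ ⊤)).op (s i) =
      φ₂.app W (M.presheaf.map (homOfLE hWV).op (b i)) := fun i => by
    rw [Scheme.Modules.restrictAdjunction_unit_app_app]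
    change (M.presheaf.map (homOfLE (V.ι_image_le _)).op ≫ M.presheaf.map _) (b i) =
      (M.presheaf.map (homOfLE hWV).op ≫ M.presheaf.map (homOfLE (V.ι.image_preimage_le W)).op) (b i)
    rw [← Functor.map_comp, ← Functor.map_comp]
    rfl
  -- the composite `(r_i) ↦ φ₁ (Σ ι_i [r_i])` is `φ₂ (Σ r_i • b_i|_W)`
  have key : ∀ r : Fin k → Γ(O, W),
      (biproduct.desc q).app W (∑ i, (biproduct.ι (fun _ : Fin k => Q) i).app W
        ((cmplπ a O n).app W (r i))) =
      φ₂.app W (∑ i, (show Γ(X, W) from r i) • M.presheaf.map (homOfLE hWV).op (b i)) := by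
    intro r
    rw [map_sum, map_sum]
    refine Finset.sum_congr rfl fun i _ => ?_
    rw [← comp_app_apply', biproduct.ι_desc, hq i W (r i), hsW i, ← Scheme.Modules.Hom.app_smul]
  -- `φ₂` is bijective on the sections over `W`
  haveI := isIso_restrict_map_restrictAdjunction_unit V M
  have hφ₂ : Function.Bijective (φ₂.app W) := app_bijective_of_isIso_restrict V φ₂ hWV
  have hbW := hb W hWV
  -- surjectivity of `cmplπ` on the affine `W`
  have hO : Coh O := ⟨IsAffineLocalizing.unit, IsAffineFiniteType.unit⟩
  have hπsurj : Function.Surjective ((cmplπ a O n).app W) :=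
    app_surjective_of_epi _ hO.loc (Coh.cokernel _ hO hO).loc hW
  -- the `M`-sum over `W` is the `E`-sum over `ι⁻¹W` with scalars `ι♯ r_i` (definitional)
  have hsumE : ∀ r : Fin k → Γ(X, W), (∑ i, r i • M.presheaf.map (homOfLE hWV).op (b i)) =
      (show Γ(E, ι ⁻¹ᵁ W) from
        ∑ i, ι.app W (r i) • E.presheaf.map (homOfLE (ι.preimage_mono hWV)).op (b i)) := fun r => rfl
  refine ⟨(injective_iff_map_eq_zero _).mpr fun d hd => ?_, fun t => ?_⟩
  · -- injectivity: write `d` as `Σ ι_i [r_i]`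
    choose r hr using fun i => hπsurj ((biproduct.π (fun _ : Fin k => Q) i).app W d)
    have hdsum : d = ∑ i, (biproduct.ι (fun _ : Fin k => Q) i).app W ((cmplπ a O n).app W (r i)) := by
      have hd' := biproduct_decomposition_univ (fun _ : Fin k => Q) W d
      refine hd'.trans (Finset.sum_congr rfl fun i _ => ?_)
      rw [hr i]
    rw [hdsum, key] at hd
    have h0 : (∑ i, (show Γ(X, W) from r i) • M.presheaf.map (homOfLE hWV).op (b i)) = 0 :=
      hφ₂.1 (by rw [hd, map_zero])
    -- the frame gives `ι♯ (r i) = 0`, hence `r i ∈ aⁿ⁺¹ Γ(W, 𝒪_X)` and `[r i] = 0`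
    have hri : (fun i => ι.app W (show Γ(X, W) from r i)) = (0 : Fin k → Γ(Z, ι ⁻¹ᵁ W)) := by
      refine hbW.1 ?_
      have hz : (fun y : Fin k → Γ(Z, ι ⁻¹ᵁ W) =>
          ∑ i, y i • E.presheaf.map (homOfLE (ι.preimage_mono hWV)).op (b i)) 0 = 0 :=
        Finset.sum_eq_zero fun i _ => by rw [Pi.zero_apply, zero_smul]
      rw [hz]
      exact h0
    rw [hdsum]
    refine Finset.sum_eq_zero fun i _ => ?_
    obtain ⟨c, hc⟩ := ((hcut W hW).2 (r i)).mp (congrFun hri i)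
    have hπ0 : (cmplπ a O n).app W (r i) = 0 := by
      have h := congrArg (fun φ => φ.app W c) (cokernel.condition (globalScalar O (a ^ (n + 1))))
      rw [comp_app_apply', globalScalar_app_apply, Scheme.Modules.Hom.zero_app] at h
      rw [hc]
      exact h
    rw [hπ0, map_zero]
  · -- surjectivity: `t = φ₂ m`, `m = Σ y_i • b_i|`, `y_i = ι♯ r_i`
    obtain ⟨m, hm⟩ := hφ₂.2 t
    obtain ⟨y, hy⟩ := hbW.2 (show Γ(E, ι ⁻¹ᵁ W) from m)
    choose r hr using fun i => (hcut W hW).1 (y i)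
    refine ⟨∑ i, (biproduct.ι (fun _ : Fin k => Q) i).app W ((cmplπ a O n).app W (r i)), ?_⟩
    rw [key, ← hm, hsumE]
    congr 1
    rw [← hy]
    exact Finset.sum_congr rfl fun i _ => by rw [← hr i]

end Cospan

/-! ### The unit of `ι_*E` is an `a`-power isogeny -/

section Unit

variable [IsClosedImmersion ι] [IsLocallyNoetherian X]
  (hcut : ∀ W : X.Opens, IsAffineOpen W → Function.Surjective (ι.app W) ∧
    ∀ r : Γ(X, W), ι.app W r = 0 ↔
      ∃ c : Γ(X, W), r = X.presheaf.map (homOfLE (le_top : W ≤ ⊤)).op (a ^ (n + 1)) * c)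
  (ha : ι.appTop (a ^ (n + 1)) = 0)
  {E : Z.Modules} (hE : IsFiniteLocallyFree E)

include hcut ha hE in
/-- **The unit `ι_*E → ρ_*ρ^*(ι_*E)` is an `a`-power isogeny** as soon as the unit of `𝒪_X/aⁿ⁺¹`
is: if `η : 𝒪/aⁿ⁺¹ → ρ_*ρ^*(𝒪/aⁿ⁺¹)` has kernel killed by `a^c₁` and cokernel killed by `a^c₂`
(generalized-element form), then the unit of `ι_*E`, `E` finite locally free on the closed subscheme
`Z = V(aⁿ⁺¹)`, has kernel killed by `a^c₁` and cokernel killed by `a^c₂`. [cite: GortzWedhorn2023, proof of Thm. 24.94 and Prop. 24.95 (pp. 566–567), auxiliary step] -/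
theorem unit_pushforward_torsion {c₁ c₂ : ℕ}
    (hQk : ∀ {T : X.Modules} (z : T ⟶ cmplObj a (unitModule X) n),
      z ≫ (Scheme.Modules.pullbackPushforwardAdjunction ρ).unit.app _ = 0 →
        z ≫ globalScalar _ (a ^ c₁) = 0)
    (hQc : ∀ {T : X.Modules} (q : (Scheme.Modules.pullback ρ ⋙ Scheme.Modules.pushforward ρ).obj
        (cmplObj a (unitModule X) n) ⟶ T),
      (Scheme.Modules.pullbackPushforwardAdjunction ρ).unit.app _ ≫ q = 0 →
        globalScalar _ (a ^ c₂) ≫ q = 0) :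
    kernel.ι ((Scheme.Modules.pullbackPushforwardAdjunction ρ).unit.app
        ((Scheme.Modules.pushforward ι).obj E)) ≫ globalScalar _ (a ^ c₁) = 0 ∧
      globalScalar _ (a ^ c₂) ≫ cokernel.π ((Scheme.Modules.pullbackPushforwardAdjunction ρ).unit.app
        ((Scheme.Modules.pushforward ι).obj E)) = 0 := by
  classical
  haveI : HasFiniteBiproducts X.Modules := CategoryTheory.Abelian.hasFiniteBiproducts
  let O : X.Modules := unitModule X
  let Q : X.Modules := cmplObj a O n
  let M : X.Modules := (Scheme.Modules.pushforward ι).obj E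
  let R := Scheme.Modules.pullback ρ ⋙ Scheme.Modules.pushforward ρ
  let η := (Scheme.Modules.pullbackPushforwardAdjunction ρ).unit
  -- bounds for `⨁_k Q`
  have hAk : ∀ k : ℕ, kernel.ι (η.app (⨁ fun _ : Fin k => Q)) ≫ globalScalar _ (a ^ c₁) = 0 :=
    fun k => kernel_ι_of_kerBound (a ^ c₁) _ fun z hz =>
      kerBound_biproduct (fun T : X.Modules => globalScalar T (a ^ c₁)) (fun f => globalScalar_comp f _)
        R η (fun _ : Fin k => Q) (fun _ _ z hz => hQk z hz) z hz
  have hAc : ∀ k : ℕ, globalScalar _ (a ^ c₂) ≫ cokernel.π (η.app (⨁ fun _ : Fin k => Q)) = 0 :=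
    fun k => cokernel_π_of_cokerBound (a ^ c₂) _ fun q hq =>
      cokerBound_biproduct (fun T : X.Modules => globalScalar T (a ^ c₂)) (fun f => globalScalar_comp f _)
        R η (fun _ : Fin k => Q) (fun _ _ q hq => hQc q hq) q hq
  -- the local cospans
  have loc : ∀ x : X, ∃ (V : X.Opens), x ∈ V ∧
      (∀ (W : X.Opens), W ≤ V → ∀ s : Γ(M, W), (η.app M).app W s = 0 →
        X.presheaf.map (homOfLE (le_top : W ≤ ⊤)).op (a ^ c₁) • s = 0) ∧
      (∀ (W : X.Opens), W ≤ V → ∀ (t : Γ(R.obj M, W)) (y : X), y ∈ W →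
        ∃ (W' : X.Opens) (hW' : W' ≤ W), y ∈ W' ∧ ∃ s : Γ(M, W'), (η.app M).app W' s =
          (R.obj M).presheaf.map (homOfLE hW').op
            (X.presheaf.map (homOfLE (le_top : W ≤ ⊤)).op (a ^ c₂) • t)) := by
    intro x
    obtain ⟨V, hxV, k, φ₁, hφ₁⟩ := exists_local_cospan ι a n hcut ha hE x
    let J : X.Modules :=
      (Scheme.Modules.pushforward V.ι).obj ((Scheme.Modules.restrictFunctor V.ι).obj M)
    let φ₂ : M ⟶ J := (Scheme.Modules.restrictAdjunction V.ι).unit.app M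
    haveI := isIso_restrict_map_restrictAdjunction_unit V M
    have h₂ : ∀ W : X.Opens, W ≤ V → Function.Bijective (φ₂.app W) :=
      fun W hW => app_bijective_of_isIso_restrict V φ₂ hW
    have h₁ : ∀ W : X.Opens, W ≤ V → Function.Bijective (φ₁.app W) :=
      app_bijective_of_bijective_affine V φ₁ hφ₁
    have hR₁ : ∀ W : X.Opens, W ≤ V → Function.Bijective ((R.map φ₁).app W) :=
      pushforward_pullback_map_app_bijective_of_le V φ₁ ρ hφ₁
    have hR₂ : ∀ W : X.Opens, W ≤ V → Function.Injective ((R.map φ₂).app W) := fun W hW =>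
      (pushforward_pullback_map_app_bijective_of_le V φ₂ ρ (fun W hW _ => h₂ W hW) W hW).1
    refine ⟨V, hxV, fun W hW s hs => ?_, fun W hW t y hy => ?_⟩
    · exact kerBound_of_cospan R η (a ^ c₁) V φ₁ φ₂ h₁ (fun W hW => (h₂ W hW).1)
        (fun W hW => (hR₁ W hW).1)
        (fun W _ q hq => smul_eq_zero_of_kernel_ι (a ^ c₁) _ (hAk k) W q hq) W hW s hs
    · exact cokerBound_of_cospan R η (a ^ c₂) V φ₁ φ₂ h₂ hR₁ hR₂
        (fun W _ t y hy => exists_local_preimage_of_cokernel_π (a ^ c₂) _ (hAc k) W t y hy)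
        W hW t y hy
  refine ⟨kernel_ι_of_sections (a ^ c₁) _ fun U s hs => ?_,
    cokernel_π_of_sections (a ^ c₂) _ fun U t y hy => ?_⟩
  · -- kernel bound: locally on the cover by the `V`'s
    refine section_eq_zero_of_locally _ _ fun y hy => ?_
    obtain ⟨V, hyV, hK, -⟩ := loc y
    refine ⟨U ⊓ V, inf_le_left, ⟨hy, hyV⟩, ?_⟩
    rw [Scheme.Modules.map_smul, ← CategoryTheory.comp_apply, ← Functor.map_comp]
    refine hK (U ⊓ V) inf_le_right _ ?_
    rw [Scheme.Modules.Hom.app_map_apply, hs, map_zero]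
  · -- cokernel bound
    obtain ⟨V, hyV, -, hC⟩ := loc y
    obtain ⟨W', hW', hyW', s, hs⟩ := hC (U ⊓ V) inf_le_right
      ((R.obj M).presheaf.map (homOfLE (inf_le_left : U ⊓ V ≤ U)).op t) y ⟨hy, hyV⟩
    refine ⟨W', hW'.trans inf_le_left, hyW', s, ?_⟩
    rw [hs, Scheme.Modules.map_smul, ← CategoryTheory.comp_apply, ← Functor.map_comp,
      Scheme.Modules.map_smul, ← CategoryTheory.comp_apply, ← Functor.map_comp,
      ← CategoryTheory.comp_apply, ← Functor.map_comp]
    rfl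

end Unit

end Literature.AlgebraicGeometry.FormalGeometry.WittGrothendieckExistence.FormalVectorBundlesAlgebraize

end
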